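import Summits.BirchSwinnertonDyer.BirchSwinnertonDyer.Theorems.EdixhovenFibreFiveSevenStarredOptimalManinUnitFiveSevenCdtThm1
import Summits.BirchSwinnertonDyer.BirchSwinnertonDyer.Theses.TeichmullerTwistDescent
import HarnessLib

set_option autoImplicit false
-- the sub-problem namespace `Summit.BirchSwinnertonDyer.BirchSwinnertonDyer` duplicates a component by design (D-0017)
set_option linter.dupNamespace false

/-!
# Route TeichmullerTwistDescent, item GE11 `OrdinaryLowValuationOptimalManinUnitGeEleven` (stmt-BirchSwinnertonDyer-23885), closed by name

GE11 (Edixhoven's own exceptional case as an item; split parent of K `TwistedPeriodLatticeSaturation`): for `W/ℚ`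
globally minimal, additive at a prime `p ≥ 11` with `E[p]` irreducible, `(G)`-ordinary, `ord_p Δ_min ≤ 4`, and `D`
a lattice-optimal conductor-level parametrisation datum (`Λ_W = c · Λ_f`): `p ∤ c(D)`.

Only the clauses «additive at `p ≥ 5`» and «lattice-optimal» are used: the landed conditional closer
`TeichmullerTwistDescentOfCDTInt.ordinaryLowValuationOptimalManinUnitGeEleven_of_CDTInt` (LEAD edix-p1 g36; it is
`EdixhovenFibreFiveSevenOfCDTInt.not_dvd_c_of_CDTInt`, p811415) takes exactly the printed Calegari–Dimitrov–Tang
Theorem 1.0.1 as hypothesis; that hypothesis is now the tree theorem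
`calegariDimitrovTang2025_unboundedDenominators_holds` (p826028, line `cdt_thm1` of crux K★ of route
EdixhovenFibreFiveSeven).  Composing the two proves the item BY NAME — directly, not through its split
(K `TwistedPeriodLatticeSaturation` 25368 and the PUB bundle 25370 stay as filed).

BSD is not proved by this; Manin's conjecture is not proved by this (the statement is one additive cell at
`p ≥ 11`); no leaf or rung closes. [cite: CalegariDimitrovTang2025, Thm. 1.0.1] [cite: EdixhovenManin1991, Thm. 3 (the exception)]
-/

namespace Summit.BirchSwinnertonDyer.BirchSwinnertonDyer.Theorems

/-- **Item GE11 `OrdinaryLowValuationOptimalManinUnitGeEleven` (stmt-BirchSwinnertonDyer-23885), proved by name**: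
`p ∤ c` at every lattice-optimal conductor-level datum of a globally minimal curve additive at `p ≥ 11`,
`(G)`-ordinary with `ord_p Δ_min ≤ 4` and `E[p]` irreducible — from CDT Theorem 1.0.1
(`calegariDimitrovTang2025_unboundedDenominators_holds`) through
`EdixhovenFibreFiveSevenOfCDTInt.not_dvd_c_of_CDTInt` (the proof of
`TeichmullerTwistDescentOfCDTInt.ordinaryLowValuationOptimalManinUnitGeEleven_of_CDTInt`, inlined); the ordinarity,
valuation and irreducibility clauses are idle.  BSD is NOT proved by this. [cite: CalegariDimitrovTang2025, Thm. 1.0.1] -/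
theorem TeichmullerTwistDescent.OrdinaryLowValuationOptimalManinUnitGeEleven_proof :
    Summit.BirchSwinnertonDyer.BirchSwinnertonDyer.Theses.TeichmullerTwistDescent.OrdinaryLowValuationOptimalManinUnitGeEleven := by
  -- the proof of `TeichmullerTwistDescentOfCDTInt.ordinaryLowValuationOptimalManinUnitGeEleven_of_CDTInt`, inlined so
  -- that this file imports the route file directly and no other module of its cone
  intro W _ _ p _ _ D h11 hadd _hirr _hord _hv hlat
  exact EdixhovenFibreFiveSevenOfCDTInt.not_dvd_c_of_CDTInt calegariDimitrovTang2025_unboundedDenominators_holds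
    D (by omega) hadd hlat

end Summit.BirchSwinnertonDyer.BirchSwinnertonDyer.Theorems
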